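import Literature.Probability.Percolation.ZdFourArmSepNonvacuity
import Literature.Probability.Percolation.ZdFiveArmSeparatedE
import HarnessLib

/-!
# Fenced right arms in prescribed row bands (towards the non-vacuity of `zdFiveArmSepE`)

Topic `Literature/Probability/Percolation`; bond percolation on `ℤ² = Site 2` at `p = 1/2`.
PROOFS ONLY (no definition, no named fact).  First brick of the initial-scale input
`(init)  c ≤ P_{1/2}(zdFiveArmSepE m N)` (`2m ≤ N ≤ 8m`) of
`DuminilCopinManolescuTassion2021_zdFiveArm_upperBound_of_separationInputs`
(`ZdFiveArmUpperBoundOfScheme.lean`): the deterministic construction of a fenced open right arm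
`ZdSepOpenArmR ω n N r₀ (r₀ + n/64) (r₀ + D) (r₀ + D + N/64)` landing in PRESCRIBED row bands
(inner `[r₀, r₀ + n/64]`, outer `[r₀ + D, r₀ + D + N/64]`) from seven open corridor crossings —
the row-band generalisation of `nonempty_zdSepOpenArmR_of_crossings`
(`ZdFourArmSepNonvacuity.lean`, rows `[0, n/64]`), needed for the two right arms `R⁺`
(`r₀ = n/4`, `r₀ + D = N/4`) and `R⁻` of `zdSepOpenPairRE` (`ZdFiveArmSeparatedE.lean`); the
middle piece runs in the tall band `[r₀, r₀ + D + n/64]`, of bounded aspect ratio when `N ≤ 8n`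
(Nolin 2008, §4.3, proof of Prop. 12 (i) and Prop. 14: RSW gluings in corridors).

## References

* P. Nolin, *Near-critical percolation in two dimensions*, EJP 13 (2008), §4.3 Prop. 12 (i),
  Prop. 14 (arXiv 0711.4948: Prop. 11 (i), Prop. 13) [Nolin2008].
* H. Kesten, *Scaling relations for 2D-percolation*, CMP 109 (1987), §2 (2.26)–(2.28), Lemma 4
  [KestenScalingCMP1987].
-/

noncomputable section

open SimpleGraph Finset

namespace Literature.Probability.Percolation

open LatticeModels _root_.MeasureTheory

/-! ### The right arm in a prescribed row band from seven open crossings -/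

section ArmRRows

variable {ω : BondConfig (Site 2)} {n N a b A B L r₀ D : ℕ}

set_option maxHeartbeats 1600000 in
/-- **Deterministic construction of the fenced right arm in a prescribed row band** (generalisation of
`nonempty_zdSepOpenArmR_of_crossings` from the row band `[0, n/64]` to the inner band
`[r₀, r₀ + n/64]`, the outer band `[r₀ + D, r₀ + D + n/64]` and the tall middle band
`[r₀, r₀ + D + n/64]`). With `b + 2 = a`, `B + 2 = A`,
`n + L + 2 = N`, `a + 1 ≤ n/8`, `n/64 + 1 ≤ n/8`, `A + 1 ≤ N/8`, `64 ≤ n`, `n + a ≤ N`, `n + A ≤ N`: on a lattice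
configuration, open left–right crossings of `[n-a, n+a] × [0, n/64]`, `[n+1, N-1] × [0, n/64]`,
`[N-A, N+A] × [0, n/64]`, open top–bottom crossings of `[n+1, n+a-1] × [0, n/64]`,
`[N-A+1, N-1] × [0, n/64]`, `[N+1, N+A-1] × [-N/64, n/64 + N/64]` and
`[n-a+1, n-1] × [-n/64, 2·n/64]` produce a fenced open arm landing on the right sides at heights
`[0, n/64]` inside and `[0, N/64]` outside (Nolin 2008, proof of Prop. 12 (i)/Prop. 14: RSW
gluings). [cite: Nolin2008, §4.3 Prop. 12 (i) and Prop. 14 (arXiv 0711.4948: Prop. 11 (i), Prop. 13)] -/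
theorem nonempty_zdSepOpenArmR_of_crossings_rows (hω : ω ⊆ (zdGraph 2).edgeSet)
    (hba : b + 2 = a) (hBA : B + 2 = A) (hL : n + L + 2 = N) (ha8 : a + 1 ≤ n / 8)
    (hh8 : n / 64 + 1 ≤ n / 8) (hA8 : A + 1 ≤ N / 8) (hn : 64 ≤ n) (hnN : n ≤ N)
    (haN : n + a ≤ N) (hAN : n + A ≤ N) (hrow : r₀ + D + n / 64 ≤ N) (hD64 : N / 64 ≤ D + n / 64)
    {lo hi lo' hi' : ℤ} (hlo : lo ≤ r₀) (hhi : (r₀ : ℤ) + (n / 64 : ℕ) ≤ hi) (hlo' : lo' ≤ (r₀ : ℤ) + D)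
    (hhi' : (r₀ : ℤ) + D + (n / 64 : ℕ) ≤ hi')
    (h₁ : ω ∈ lrCrossingAt ![(n : ℤ) - a, r₀] (2 * a) (n / 64))
    (h₂ : ω ∈ tbCrossingAt' ![(n : ℤ) + 1, r₀] b (D + n / 64))
    (h₃ : ω ∈ lrCrossingAt ![(n : ℤ) + 1, r₀] L (D + n / 64))
    (h₄ : ω ∈ tbCrossingAt' ![(N : ℤ) - A + 1, r₀] B (D + n / 64))
    (h₅ : ω ∈ lrCrossingAt ![(N : ℤ) - A, (r₀ : ℤ) + D] (2 * A) (n / 64))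
    (h₆ : ω ∈ tbCrossingAt' ![(N : ℤ) + 1, (r₀ : ℤ) + D - ((N / 64 : ℕ) : ℤ)] B (n / 64 + 2 * (N / 64)))
    (h₇ : ω ∈ tbCrossingAt' ![(n : ℤ) - a + 1, (r₀ : ℤ) - ((n / 64 : ℕ) : ℤ)] b (3 * (n / 64))) :
    ∃ A : ZdSepOpenArmR ω n N lo hi lo' hi', ∀ v ∈ A.carrier, (r₀ : ℤ) - (n / 64 : ℕ) ≤ v 1 := by
  classical
  have hhN : n / 64 ≤ N / 64 := Nat.div_le_div_right hnN
  have hhN' : ((n / 64 : ℕ) : ℤ) ≤ (N / 64 : ℕ) := by exact_mod_cast hhN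
  have hh8' : ((n / 64 : ℕ) : ℤ) + 1 ≤ (n / 8 : ℕ) := by exact_mod_cast hh8
  have hNh8 : N / 64 + 1 ≤ N / 8 := by omega
  have hNh8' : ((N / 64 : ℕ) : ℤ) + 1 ≤ (N / 8 : ℕ) := by exact_mod_cast hNh8
  have ha8' : (a : ℤ) + 1 ≤ (n / 8 : ℕ) := by exact_mod_cast ha8
  have hA8' : (A : ℤ) + 1 ≤ (N / 8 : ℕ) := by exact_mod_cast hA8
  have hn8 : ((n / 8 : ℕ) : ℤ) ≤ n := by exact_mod_cast Nat.div_le_self n 8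
  have hN8 : ((N / 8 : ℕ) : ℤ) ≤ N := by exact_mod_cast Nat.div_le_self N 8
  have hh0 : (0 : ℤ) ≤ (n / 64 : ℕ) := by positivity
  have hh'0 : (0 : ℤ) ≤ (N / 64 : ℕ) := by positivity
  -- the seven crossings as walks
  obtain ⟨s₁, y₁, T₁, hs₁, hy₁, hT₁s, hT₁e⟩ := exists_walk_of_mem_lrCrossingAt hω h₁
  obtain ⟨c₂, d₂, V₁, hc₂, hd₂, hV₁s, hV₁e⟩ := exists_walk_of_mem_tbCrossingAt hω h₂
  obtain ⟨s₃, y₃, H, hs₃, hy₃, hHs, hHe⟩ := exists_walk_of_mem_lrCrossingAt hω h₃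
  obtain ⟨c₄, d₄, V₂, hc₄, hd₄, hV₂s, hV₂e⟩ := exists_walk_of_mem_tbCrossingAt hω h₄
  obtain ⟨s₅, y₅, T₃, hs₅, hy₅, hT₃s, hT₃e⟩ := exists_walk_of_mem_lrCrossingAt hω h₅
  obtain ⟨c₆, d₆, V₆, hc₆, hd₆, hV₆s, hV₆e⟩ := exists_walk_of_mem_tbCrossingAt hω h₆
  obtain ⟨c₇, d₇, V₇, hc₇, hd₇, hV₇s, hV₇e⟩ := exists_walk_of_mem_tbCrossingAt hω h₇
  simp only [Matrix.cons_val_zero, Matrix.cons_val_one] at hs₁ hy₁ hT₁s hc₂ hd₂ hV₁s hs₃ hy₃ hHs hc₄ hd₄ hV₂s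
  simp only [Matrix.cons_val_zero, Matrix.cons_val_one] at hs₅ hy₅ hT₃s hc₆ hd₆ hV₆s hc₇ hd₇ hV₇s
  simp only [Nat.cast_mul, Nat.cast_ofNat] at hs₁ hy₁ hT₁s hc₂ hd₂ hV₁s hs₃ hy₃ hHs
  simp only [Nat.cast_add, Nat.cast_mul, Nat.cast_ofNat] at hc₄ hd₄ hV₂s hs₅ hy₅ hT₃s hc₆ hd₆ hV₆s
  simp only [Nat.cast_mul, Nat.cast_ofNat] at hc₇ hd₇ hV₇s
  -- `x`: the last visit of `T₁` to the column `n`; `W₁` the rest of `T₁`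
  obtain ⟨x, U₁, hx0, hU₁s, hU₁e⟩ :=
    exists_prefix_reach_le 0 T₁.reverse (n : ℤ) (by rw [hy₁]; omega) (by rw [hs₁]; omega)
  set W₁ : (zdGraph 2).Walk x y₁ := U₁.reverse with hW₁
  have hW₁s : ∀ z ∈ W₁.support, (n : ℤ) ≤ z 0 ∧ z 0 ≤ n + a ∧ (r₀ : ℤ) ≤ z 1 ∧ z 1 ≤ r₀ + (n / 64 : ℕ) := by
    intro z hz
    rw [hW₁, Walk.support_reverse, List.mem_reverse] at hz
    obtain ⟨hz1, hz2⟩ := hU₁s z hz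
    rw [Walk.support_reverse, List.mem_reverse] at hz2
    have := hT₁s z hz2
    exact ⟨hz1, by omega, this.2.2.1, this.2.2.2⟩
  have hW₁e : ∀ e ∈ W₁.edges, e ∈ ω := by
    intro e he
    rw [hW₁, Walk.edges_reverse, List.mem_reverse] at he
    have := hU₁e e he
    rw [Walk.edges_reverse, List.mem_reverse] at this
    exact hT₁e e this
  have hxT₁ : x ∈ T₁.support := by
    have := (hU₁s x U₁.end_mem_support).2
    rwa [Walk.support_reverse, List.mem_reverse] at this
  have hxrow : (r₀ : ℤ) ≤ x 1 ∧ x 1 ≤ r₀ + (n / 64 : ℕ) := ⟨(hT₁s x hxT₁).2.2.1, (hT₁s x hxT₁).2.2.2⟩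
  -- `m₁`: `W₁` meets the joint `V₁`
  obtain ⟨m₁, hm₁W, hm₁V⟩ := exists_mem_support_of_vFence (L := (n : ℤ)) (R := (n : ℤ) + a) (B₀ := (r₀ : ℤ)) (B₁ := (r₀ : ℤ) + (n / 64 : ℕ))
    V₁ (fun z hz => ⟨by have := hV₁s z hz; omega, by have := hV₁s z hz; omega⟩) (by omega) (by omega) (by omega)
    W₁ hx0 (by omega) hW₁s
  -- `m₁'`: the long crossing `H` meets `V₁`; `m₂'`: `H` meets `V₂`
  obtain ⟨m₁', hm₁'H, hm₁'V⟩ := exists_mem_support_of_vFence (L := (n : ℤ) + 1) (R := (N : ℤ) - 1) (B₀ := (r₀ : ℤ)) (B₁ := (r₀ : ℤ) + (D + n / 64 : ℕ))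
    V₁ (fun z hz => ⟨by have := hV₁s z hz; omega, by have := hV₁s z hz; omega⟩) (by omega) (by omega) (by omega)
    H hs₃ (by omega) (fun z hz => by have := hHs z hz; omega)
  obtain ⟨m₂', hm₂'H, hm₂'V⟩ := exists_mem_support_of_vFence (L := (n : ℤ) + 1) (R := (N : ℤ) - 1) (B₀ := (r₀ : ℤ)) (B₁ := (r₀ : ℤ) + (D + n / 64 : ℕ))
    V₂ (fun z hz => ⟨by have := hV₂s z hz; omega, by have := hV₂s z hz; omega⟩) (by omega) (by omega) (by omega)
    H hs₃ (by omega) (fun z hz => by have := hHs z hz; omega)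
  -- `z`: the first visit of `T₃` to the column `N`; `P₃` the part of `T₃` before it
  obtain ⟨z, P₃, hz0, hP₃s, hP₃e⟩ := exists_prefix_reach_ge 0 T₃ (N : ℤ) (by rw [hs₅]; omega) (by rw [hy₅]; omega)
  have hP₃s' : ∀ w ∈ P₃.support, (N : ℤ) - A ≤ w 0 ∧ w 0 ≤ N ∧ (r₀ : ℤ) + D ≤ w 1 ∧ w 1 ≤ (r₀ : ℤ) + D + (n / 64 : ℕ) := by
    intro w hw
    obtain ⟨hw1, hw2⟩ := hP₃s w hw
    have := hT₃s w hw2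
    exact ⟨this.1, hw1, this.2.2.1, this.2.2.2⟩
  have hzT₃ : z ∈ T₃.support := (hP₃s z P₃.end_mem_support).2
  have hzrow : (r₀ : ℤ) + D ≤ z 1 ∧ z 1 ≤ (r₀ : ℤ) + D + (n / 64 : ℕ) := ⟨(hT₃s z hzT₃).2.2.1, (hT₃s z hzT₃).2.2.2⟩
  -- `m₂`: `P₃` meets `V₂`
  obtain ⟨m₂, hm₂P, hm₂V⟩ := exists_mem_support_of_vFence (L := (N : ℤ) - A) (R := (N : ℤ)) (B₀ := (r₀ : ℤ) + D) (B₁ := (r₀ : ℤ) + D + (n / 64 : ℕ))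
    V₂ (fun z hz => ⟨by have := hV₂s z hz; omega, by have := hV₂s z hz; omega⟩) (by omega) (by omega) (by omega)
    P₃ hs₅ hz0 hP₃s'
  -- the joints and the middle piece
  obtain ⟨Q₁, hQ₁s, hQ₁e⟩ := exists_walk_within_support V₁ hm₁V hm₁'V
  obtain ⟨Q₂, hQ₂s, hQ₂e⟩ := exists_walk_within_support H hm₁'H hm₂'H
  obtain ⟨Q₃, hQ₃s, hQ₃e⟩ := exists_walk_within_support V₂ hm₂'V hm₂V
  -- the body
  set W : (zdGraph 2).Walk x z :=
    (W₁.takeUntil m₁ hm₁W).append (Q₁.append (Q₂.append (Q₃.append (P₃.dropUntil m₂ hm₂P)))) with hW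
  have hbox : ∀ w ∈ W.support, (n : ℤ) ≤ w 0 ∧ w 0 ≤ N ∧ (r₀ : ℤ) ≤ w 1 ∧ w 1 ≤ (r₀ : ℤ) + D + (n / 64 : ℕ) := by
    intro w hw
    simp only [hW, Walk.mem_support_append_iff] at hw
    rcases hw with hw | hw | hw | hw | hw
    · have := hW₁s w (W₁.support_takeUntil_subset_support hm₁W hw); omega
    · have := hV₁s w (hQ₁s w hw); omega
    · have := hHs w (hQ₂s w hw); omega
    · have := hV₂s w (hQ₃s w hw); omega
    · have := hP₃s' w (P₃.support_dropUntil_subset_support hm₂P hw); omega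
  have hWo : ∀ e ∈ W.edges, e ∈ ω := by
    intro e he
    simp only [hW, Walk.edges_append, List.mem_append] at he
    rcases he with he | he | he | he | he
    · exact hW₁e e (W₁.edges_takeUntil_subset_edges hm₁W he)
    · exact hV₁e e (hQ₁e e he)
    · exact hHe e (hQ₂e e he)
    · exact hV₂e e (hQ₃e e he)
    · exact hT₃e e (hP₃e e (P₃.edges_dropUntil_subset_edges hm₂P he))
  -- the outer fence: the segment of `V₆` between the rows `z₁ ∓ N/64`
  obtain ⟨a₆, b₆, V, ha₆, hb₆, hVs, hVe⟩ :=
    exists_segment_between 1 V₆ (z 1 - (N / 64 : ℕ)) (z 1 + (N / 64 : ℕ)) (by rw [hc₆]; omega) (by rw [hd₆]; omega) (by omega)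
  -- `S`: the part of `T₃` after its last visit to the column `N`
  obtain ⟨z', U₅, hz'0, hU₅s, hU₅e⟩ :=
    exists_prefix_reach_le 0 T₃.reverse (N : ℤ) (by rw [hy₅]; omega) (by rw [hs₅]; omega)
  have hSs : ∀ w ∈ U₅.reverse.support, (N : ℤ) ≤ w 0 ∧ w 0 ≤ N + A ∧ z 1 - (N / 64 : ℕ) ≤ w 1 ∧ w 1 ≤ z 1 + (N / 64 : ℕ) := by
    intro w hw
    rw [Walk.support_reverse, List.mem_reverse] at hw
    obtain ⟨hw1, hw2⟩ := hU₅s w hw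
    rw [Walk.support_reverse, List.mem_reverse] at hw2
    have := hT₃s w hw2
    exact ⟨hw1, by omega, by omega, by omega⟩
  obtain ⟨u, huS, huV⟩ := exists_mem_support_of_vFence (L := (N : ℤ)) (R := (N : ℤ) + A) (B₀ := z 1 - (N / 64 : ℕ)) (B₁ := z 1 + (N / 64 : ℕ))
    V (fun w hw => ⟨by have := hV₆s w (hVs w hw).2.2; omega, by have := hV₆s w (hVs w hw).2.2; omega⟩)
    (le_of_eq ha₆) (le_of_eq hb₆.symm) (by omega) U₅.reverse hz'0 (by rw [hy₅]; omega) hSs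
  have huT₃ : u ∈ T₃.support := by
    rw [Walk.support_reverse, List.mem_reverse] at huS
    have := (hU₅s u huS).2
    rwa [Walk.support_reverse, List.mem_reverse] at this
  obtain ⟨P, hPs, hPe⟩ := exists_walk_within_support T₃ hzT₃ huT₃
  -- the inner fence: the segment of `V₇` between the rows `x₁ ∓ n/64`
  obtain ⟨a₇, b₇, V', ha₇, hb₇, hV's, hV'e⟩ :=
    exists_segment_between 1 V₇ (x 1 - (n / 64 : ℕ)) (x 1 + (n / 64 : ℕ)) (by rw [hc₇]; omega) (by rw [hd₇]; omega) (by omega)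
  -- `P₁`: the part of `T₁` before its first visit to the column `n`
  obtain ⟨x'', P₁, hx''0, hP₁s, hP₁e⟩ := exists_prefix_reach_ge 0 T₁ (n : ℤ) (by rw [hs₁]; omega) (by rw [hy₁]; omega)
  obtain ⟨u', hu'P, hu'V⟩ := exists_mem_support_of_vFence (L := (n : ℤ) - a) (R := (n : ℤ)) (B₀ := x 1 - (n / 64 : ℕ)) (B₁ := x 1 + (n / 64 : ℕ))
    V' (fun w hw => ⟨by have := hV₇s w (hV's w hw).2.2; omega, by have := hV₇s w (hV's w hw).2.2; omega⟩)
    (le_of_eq ha₇) (le_of_eq hb₇.symm) (by omega) P₁ hs₁ hx''0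
    (fun w hw => by have := hT₁s w (hP₁s w hw).2; have := (hP₁s w hw).1; omega)
  have hu'T₁ : u' ∈ T₁.support := (hP₁s u' hu'P).2
  obtain ⟨P', hP's, hP'e⟩ := exists_walk_within_support T₁ hxT₁ hu'T₁
  refine ⟨{ x := x, z := z, W := W
            hx := ⟨hx0, by omega, by omega⟩
            hz := ⟨hz0, by omega, by omega⟩
            hW := fun w hw => mem_sqAnnulus_of_bounds (r := n) (R := N) (by omega)
              (by have := hbox w hw; omega) (by have := hbox w hw; omega) (by have := hbox w hw; omega)
              (by have := hbox w hw; have : ((r₀ + D + n / 64 : ℕ) : ℤ) ≤ N := by exact_mod_cast hrow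
                  push_cast at this; omega)
              (Or.inl (hbox w hw).1)
            hWo := hWo
            a := a₆, b := b₆, u := u, V := V, P := P
            hab := ⟨ha₆, hb₆⟩
            hV := fun w hw => ?_
            hVo := fun e he => hV₆e e (hVe e he)
            hu := huV
            hP := fun w hw => ?_
            hPo := fun e he => hT₃e e (hPe e he)
            a' := a₇, b' := b₇, u' := u', V' := V', P' := P'
            hab' := ⟨ha₇, hb₇⟩
            hV' := fun w hw => ?_
            hV'o := fun e he => hV₇e e (hV'e e he)
            hu' := hu'V
            hP' := fun w hw => ?_
            hP'o := fun e he => hT₁e e (hP'e e he) }, fun v hv => ?_⟩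
  · obtain ⟨h1, h2, h3⟩ := hVs w hw
    have := hV₆s w h3
    exact ⟨by omega, by omega, abs_le.2 ⟨by omega, by omega⟩⟩
  · have := hT₃s w (hPs w hw)
    rw [hz0]
    constructor
    · have : |w 0 - (N : ℤ)| ≤ A := abs_le.2 ⟨by omega, by omega⟩; omega
    · have : |w 1 - z 1| ≤ (n / 64 : ℕ) := abs_le.2 ⟨by omega, by omega⟩; omega
  · obtain ⟨h1, h2, h3⟩ := hV's w hw
    have := hV₇s w h3
    exact ⟨by omega, by omega, abs_le.2 ⟨by omega, by omega⟩⟩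
  · have := hT₁s w (hP's w hw)
    rw [hx0]
    constructor
    · have : |w 0 - (n : ℤ)| ≤ a := abs_le.2 ⟨by omega, by omega⟩; omega
    · have : |w 1 - x 1| ≤ (n / 64 : ℕ) := abs_le.2 ⟨by omega, by omega⟩; omega
  · -- rows of the carrier
    simp only [ZdSepOpenArmR.carrier, Set.mem_setOf_eq] at hv
    rcases hv with hv | hv | hv | hv | hv
    · have := hbox v hv; omega
    · have := hV₆s v (hVs v hv).2.2; have := (hVs v hv).1; omega
    · have := hT₃s v (hPs v hv); omega
    · have := hV₇s v (hV's v hv).2.2; have := (hV's v hv).1; have := (hV's v hv).2.1; omega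
    · have := hT₁s v (hP's v hv); omega


end ArmRRows

/-! ### The right arm in a prescribed row band, outer band below the inner band -/

section ArmRRowsDesc

variable {ω : BondConfig (Site 2)} {n N a b A B L D : ℕ} {r₀ : ℤ}

set_option maxHeartbeats 1600000 in
/-- **Deterministic construction of the fenced right arm in a prescribed row band, descending**
(the outer band `[r₀ - D, r₀ - D + n/64]` BELOW the inner band `[r₀, r₀ + n/64]`, middle piece in
the tall band `[r₀ - D, r₀ + n/64]`; rows may be negative). With `b + 2 = a`, `B + 2 = A`,
`n + L + 2 = N`, `a + 1 ≤ n/8`, `n/64 + 1 ≤ n/8`, `A + 1 ≤ N/8`, `64 ≤ n`, `n + a ≤ N`, `n + A ≤ N`: on a lattice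
configuration, open left–right crossings of `[n-a, n+a] × [0, n/64]`, `[n+1, N-1] × [0, n/64]`,
`[N-A, N+A] × [0, n/64]`, open top–bottom crossings of `[n+1, n+a-1] × [0, n/64]`,
`[N-A+1, N-1] × [0, n/64]`, `[N+1, N+A-1] × [-N/64, n/64 + N/64]` and
`[n-a+1, n-1] × [-n/64, 2·n/64]` produce a fenced open arm landing on the right sides at heights
`[0, n/64]` inside and `[0, N/64]` outside (Nolin 2008, proof of Prop. 12 (i)/Prop. 14: RSW
gluings). [cite: Nolin2008, §4.3 Prop. 12 (i) and Prop. 14 (arXiv 0711.4948: Prop. 11 (i), Prop. 13)] -/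
theorem nonempty_zdSepOpenArmR_of_crossings_rows' (hω : ω ⊆ (zdGraph 2).edgeSet)
    (hba : b + 2 = a) (hBA : B + 2 = A) (hL : n + L + 2 = N) (ha8 : a + 1 ≤ n / 8)
    (hh8 : n / 64 + 1 ≤ n / 8) (hA8 : A + 1 ≤ N / 8) (hn : 64 ≤ n) (hnN : n ≤ N)
    (haN : n + a ≤ N) (hAN : n + A ≤ N) (hrow : r₀ + (n / 64 : ℕ) ≤ N) (hrow' : -(N : ℤ) ≤ r₀ - D)
    (hD64 : N / 64 ≤ D + n / 64)
    {lo hi lo' hi' : ℤ} (hlo : lo ≤ r₀) (hhi : r₀ + (n / 64 : ℕ) ≤ hi) (hlo' : lo' ≤ r₀ - D)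
    (hhi' : r₀ - D + (n / 64 : ℕ) ≤ hi')
    (h₁ : ω ∈ lrCrossingAt ![(n : ℤ) - a, r₀] (2 * a) (n / 64))
    (h₂ : ω ∈ tbCrossingAt' ![(n : ℤ) + 1, r₀ - D] b (D + n / 64))
    (h₃ : ω ∈ lrCrossingAt ![(n : ℤ) + 1, r₀ - D] L (D + n / 64))
    (h₄ : ω ∈ tbCrossingAt' ![(N : ℤ) - A + 1, r₀ - D] B (D + n / 64))
    (h₅ : ω ∈ lrCrossingAt ![(N : ℤ) - A, r₀ - D] (2 * A) (n / 64))
    (h₆ : ω ∈ tbCrossingAt' ![(N : ℤ) + 1, r₀ - D - ((N / 64 : ℕ) : ℤ)] B (n / 64 + 2 * (N / 64)))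
    (h₇ : ω ∈ tbCrossingAt' ![(n : ℤ) - a + 1, r₀ - ((n / 64 : ℕ) : ℤ)] b (3 * (n / 64))) :
    ∃ A : ZdSepOpenArmR ω n N lo hi lo' hi', ∀ v ∈ A.carrier, v 1 ≤ r₀ + 2 * (n / 64 : ℕ) := by
  classical
  have hhN : n / 64 ≤ N / 64 := Nat.div_le_div_right hnN
  have hhN' : ((n / 64 : ℕ) : ℤ) ≤ (N / 64 : ℕ) := by exact_mod_cast hhN
  have hh8' : ((n / 64 : ℕ) : ℤ) + 1 ≤ (n / 8 : ℕ) := by exact_mod_cast hh8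
  have hNh8 : N / 64 + 1 ≤ N / 8 := by omega
  have hNh8' : ((N / 64 : ℕ) : ℤ) + 1 ≤ (N / 8 : ℕ) := by exact_mod_cast hNh8
  have ha8' : (a : ℤ) + 1 ≤ (n / 8 : ℕ) := by exact_mod_cast ha8
  have hA8' : (A : ℤ) + 1 ≤ (N / 8 : ℕ) := by exact_mod_cast hA8
  have hn8 : ((n / 8 : ℕ) : ℤ) ≤ n := by exact_mod_cast Nat.div_le_self n 8
  have hN8 : ((N / 8 : ℕ) : ℤ) ≤ N := by exact_mod_cast Nat.div_le_self N 8
  have hh0 : (0 : ℤ) ≤ (n / 64 : ℕ) := by positivity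
  have hh'0 : (0 : ℤ) ≤ (N / 64 : ℕ) := by positivity
  -- the seven crossings as walks
  obtain ⟨s₁, y₁, T₁, hs₁, hy₁, hT₁s, hT₁e⟩ := exists_walk_of_mem_lrCrossingAt hω h₁
  obtain ⟨c₂, d₂, V₁, hc₂, hd₂, hV₁s, hV₁e⟩ := exists_walk_of_mem_tbCrossingAt hω h₂
  obtain ⟨s₃, y₃, H, hs₃, hy₃, hHs, hHe⟩ := exists_walk_of_mem_lrCrossingAt hω h₃
  obtain ⟨c₄, d₄, V₂, hc₄, hd₄, hV₂s, hV₂e⟩ := exists_walk_of_mem_tbCrossingAt hω h₄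
  obtain ⟨s₅, y₅, T₃, hs₅, hy₅, hT₃s, hT₃e⟩ := exists_walk_of_mem_lrCrossingAt hω h₅
  obtain ⟨c₆, d₆, V₆, hc₆, hd₆, hV₆s, hV₆e⟩ := exists_walk_of_mem_tbCrossingAt hω h₆
  obtain ⟨c₇, d₇, V₇, hc₇, hd₇, hV₇s, hV₇e⟩ := exists_walk_of_mem_tbCrossingAt hω h₇
  simp only [Matrix.cons_val_zero, Matrix.cons_val_one] at hs₁ hy₁ hT₁s hc₂ hd₂ hV₁s hs₃ hy₃ hHs hc₄ hd₄ hV₂s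
  simp only [Matrix.cons_val_zero, Matrix.cons_val_one] at hs₅ hy₅ hT₃s hc₆ hd₆ hV₆s hc₇ hd₇ hV₇s
  simp only [Nat.cast_mul, Nat.cast_ofNat] at hs₁ hy₁ hT₁s hc₂ hd₂ hV₁s hs₃ hy₃ hHs
  simp only [Nat.cast_add, Nat.cast_mul, Nat.cast_ofNat] at hc₄ hd₄ hV₂s hs₅ hy₅ hT₃s hc₆ hd₆ hV₆s
  simp only [Nat.cast_mul, Nat.cast_ofNat] at hc₇ hd₇ hV₇s
  -- `x`: the last visit of `T₁` to the column `n`; `W₁` the rest of `T₁`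
  obtain ⟨x, U₁, hx0, hU₁s, hU₁e⟩ :=
    exists_prefix_reach_le 0 T₁.reverse (n : ℤ) (by rw [hy₁]; omega) (by rw [hs₁]; omega)
  set W₁ : (zdGraph 2).Walk x y₁ := U₁.reverse with hW₁
  have hW₁s : ∀ z ∈ W₁.support, (n : ℤ) ≤ z 0 ∧ z 0 ≤ n + a ∧ r₀ ≤ z 1 ∧ z 1 ≤ r₀ + (n / 64 : ℕ) := by
    intro z hz
    rw [hW₁, Walk.support_reverse, List.mem_reverse] at hz
    obtain ⟨hz1, hz2⟩ := hU₁s z hz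
    rw [Walk.support_reverse, List.mem_reverse] at hz2
    have := hT₁s z hz2
    exact ⟨hz1, by omega, this.2.2.1, this.2.2.2⟩
  have hW₁e : ∀ e ∈ W₁.edges, e ∈ ω := by
    intro e he
    rw [hW₁, Walk.edges_reverse, List.mem_reverse] at he
    have := hU₁e e he
    rw [Walk.edges_reverse, List.mem_reverse] at this
    exact hT₁e e this
  have hxT₁ : x ∈ T₁.support := by
    have := (hU₁s x U₁.end_mem_support).2
    rwa [Walk.support_reverse, List.mem_reverse] at this
  have hxrow : r₀ ≤ x 1 ∧ x 1 ≤ r₀ + (n / 64 : ℕ) := ⟨(hT₁s x hxT₁).2.2.1, (hT₁s x hxT₁).2.2.2⟩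
  -- `m₁`: `W₁` meets the joint `V₁`
  obtain ⟨m₁, hm₁W, hm₁V⟩ := exists_mem_support_of_vFence (L := (n : ℤ)) (R := (n : ℤ) + a) (B₀ := r₀) (B₁ := r₀ + (n / 64 : ℕ))
    V₁ (fun z hz => ⟨by have := hV₁s z hz; omega, by have := hV₁s z hz; omega⟩) (by omega) (by omega) (by omega)
    W₁ hx0 (by omega) hW₁s
  -- `m₁'`: the long crossing `H` meets `V₁`; `m₂'`: `H` meets `V₂`
  obtain ⟨m₁', hm₁'H, hm₁'V⟩ := exists_mem_support_of_vFence (L := (n : ℤ) + 1) (R := (N : ℤ) - 1) (B₀ := r₀ - D) (B₁ := r₀ - D + (D + n / 64 : ℕ))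
    V₁ (fun z hz => ⟨by have := hV₁s z hz; omega, by have := hV₁s z hz; omega⟩) (by omega) (by omega) (by omega)
    H hs₃ (by omega) (fun z hz => by have := hHs z hz; omega)
  obtain ⟨m₂', hm₂'H, hm₂'V⟩ := exists_mem_support_of_vFence (L := (n : ℤ) + 1) (R := (N : ℤ) - 1) (B₀ := r₀ - D) (B₁ := r₀ - D + (D + n / 64 : ℕ))
    V₂ (fun z hz => ⟨by have := hV₂s z hz; omega, by have := hV₂s z hz; omega⟩) (by omega) (by omega) (by omega)
    H hs₃ (by omega) (fun z hz => by have := hHs z hz; omega)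
  -- `z`: the first visit of `T₃` to the column `N`; `P₃` the part of `T₃` before it
  obtain ⟨z, P₃, hz0, hP₃s, hP₃e⟩ := exists_prefix_reach_ge 0 T₃ (N : ℤ) (by rw [hs₅]; omega) (by rw [hy₅]; omega)
  have hP₃s' : ∀ w ∈ P₃.support, (N : ℤ) - A ≤ w 0 ∧ w 0 ≤ N ∧ r₀ - D ≤ w 1 ∧ w 1 ≤ r₀ - D + (n / 64 : ℕ) := by
    intro w hw
    obtain ⟨hw1, hw2⟩ := hP₃s w hw
    have := hT₃s w hw2
    exact ⟨this.1, hw1, this.2.2.1, this.2.2.2⟩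
  have hzT₃ : z ∈ T₃.support := (hP₃s z P₃.end_mem_support).2
  have hzrow : r₀ - D ≤ z 1 ∧ z 1 ≤ r₀ - D + (n / 64 : ℕ) := ⟨(hT₃s z hzT₃).2.2.1, (hT₃s z hzT₃).2.2.2⟩
  -- `m₂`: `P₃` meets `V₂`
  obtain ⟨m₂, hm₂P, hm₂V⟩ := exists_mem_support_of_vFence (L := (N : ℤ) - A) (R := (N : ℤ)) (B₀ := r₀ - D) (B₁ := r₀ - D + (n / 64 : ℕ))
    V₂ (fun z hz => ⟨by have := hV₂s z hz; omega, by have := hV₂s z hz; omega⟩) (by omega) (by omega) (by omega)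
    P₃ hs₅ hz0 hP₃s'
  -- the joints and the middle piece
  obtain ⟨Q₁, hQ₁s, hQ₁e⟩ := exists_walk_within_support V₁ hm₁V hm₁'V
  obtain ⟨Q₂, hQ₂s, hQ₂e⟩ := exists_walk_within_support H hm₁'H hm₂'H
  obtain ⟨Q₃, hQ₃s, hQ₃e⟩ := exists_walk_within_support V₂ hm₂'V hm₂V
  -- the body
  set W : (zdGraph 2).Walk x z :=
    (W₁.takeUntil m₁ hm₁W).append (Q₁.append (Q₂.append (Q₃.append (P₃.dropUntil m₂ hm₂P)))) with hW
  have hbox : ∀ w ∈ W.support, (n : ℤ) ≤ w 0 ∧ w 0 ≤ N ∧ r₀ - D ≤ w 1 ∧ w 1 ≤ r₀ + (n / 64 : ℕ) := by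
    intro w hw
    simp only [hW, Walk.mem_support_append_iff] at hw
    rcases hw with hw | hw | hw | hw | hw
    · have := hW₁s w (W₁.support_takeUntil_subset_support hm₁W hw); omega
    · have := hV₁s w (hQ₁s w hw); omega
    · have := hHs w (hQ₂s w hw); omega
    · have := hV₂s w (hQ₃s w hw); omega
    · have := hP₃s' w (P₃.support_dropUntil_subset_support hm₂P hw); omega
  have hWo : ∀ e ∈ W.edges, e ∈ ω := by
    intro e he
    simp only [hW, Walk.edges_append, List.mem_append] at he
    rcases he with he | he | he | he | he
    · exact hW₁e e (W₁.edges_takeUntil_subset_edges hm₁W he)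
    · exact hV₁e e (hQ₁e e he)
    · exact hHe e (hQ₂e e he)
    · exact hV₂e e (hQ₃e e he)
    · exact hT₃e e (hP₃e e (P₃.edges_dropUntil_subset_edges hm₂P he))
  -- the outer fence: the segment of `V₆` between the rows `z₁ ∓ N/64`
  obtain ⟨a₆, b₆, V, ha₆, hb₆, hVs, hVe⟩ :=
    exists_segment_between 1 V₆ (z 1 - (N / 64 : ℕ)) (z 1 + (N / 64 : ℕ)) (by rw [hc₆]; omega) (by rw [hd₆]; omega) (by omega)
  -- `S`: the part of `T₃` after its last visit to the column `N`
  obtain ⟨z', U₅, hz'0, hU₅s, hU₅e⟩ :=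
    exists_prefix_reach_le 0 T₃.reverse (N : ℤ) (by rw [hy₅]; omega) (by rw [hs₅]; omega)
  have hSs : ∀ w ∈ U₅.reverse.support, (N : ℤ) ≤ w 0 ∧ w 0 ≤ N + A ∧ z 1 - (N / 64 : ℕ) ≤ w 1 ∧ w 1 ≤ z 1 + (N / 64 : ℕ) := by
    intro w hw
    rw [Walk.support_reverse, List.mem_reverse] at hw
    obtain ⟨hw1, hw2⟩ := hU₅s w hw
    rw [Walk.support_reverse, List.mem_reverse] at hw2
    have := hT₃s w hw2
    exact ⟨hw1, by omega, by omega, by omega⟩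
  obtain ⟨u, huS, huV⟩ := exists_mem_support_of_vFence (L := (N : ℤ)) (R := (N : ℤ) + A) (B₀ := z 1 - (N / 64 : ℕ)) (B₁ := z 1 + (N / 64 : ℕ))
    V (fun w hw => ⟨by have := hV₆s w (hVs w hw).2.2; omega, by have := hV₆s w (hVs w hw).2.2; omega⟩)
    (le_of_eq ha₆) (le_of_eq hb₆.symm) (by omega) U₅.reverse hz'0 (by rw [hy₅]; omega) hSs
  have huT₃ : u ∈ T₃.support := by
    rw [Walk.support_reverse, List.mem_reverse] at huS
    have := (hU₅s u huS).2
    rwa [Walk.support_reverse, List.mem_reverse] at this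
  obtain ⟨P, hPs, hPe⟩ := exists_walk_within_support T₃ hzT₃ huT₃
  -- the inner fence: the segment of `V₇` between the rows `x₁ ∓ n/64`
  obtain ⟨a₇, b₇, V', ha₇, hb₇, hV's, hV'e⟩ :=
    exists_segment_between 1 V₇ (x 1 - (n / 64 : ℕ)) (x 1 + (n / 64 : ℕ)) (by rw [hc₇]; omega) (by rw [hd₇]; omega) (by omega)
  -- `P₁`: the part of `T₁` before its first visit to the column `n`
  obtain ⟨x'', P₁, hx''0, hP₁s, hP₁e⟩ := exists_prefix_reach_ge 0 T₁ (n : ℤ) (by rw [hs₁]; omega) (by rw [hy₁]; omega)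
  obtain ⟨u', hu'P, hu'V⟩ := exists_mem_support_of_vFence (L := (n : ℤ) - a) (R := (n : ℤ)) (B₀ := x 1 - (n / 64 : ℕ)) (B₁ := x 1 + (n / 64 : ℕ))
    V' (fun w hw => ⟨by have := hV₇s w (hV's w hw).2.2; omega, by have := hV₇s w (hV's w hw).2.2; omega⟩)
    (le_of_eq ha₇) (le_of_eq hb₇.symm) (by omega) P₁ hs₁ hx''0
    (fun w hw => by have := hT₁s w (hP₁s w hw).2; have := (hP₁s w hw).1; omega)
  have hu'T₁ : u' ∈ T₁.support := (hP₁s u' hu'P).2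
  obtain ⟨P', hP's, hP'e⟩ := exists_walk_within_support T₁ hxT₁ hu'T₁
  refine ⟨{ x := x, z := z, W := W
            hx := ⟨hx0, by omega, by omega⟩
            hz := ⟨hz0, by omega, by omega⟩
            hW := fun w hw => mem_sqAnnulus_of_bounds (r := n) (R := N) (by omega)
              (by have := hbox w hw; omega) (by have := hbox w hw; omega) (by have := hbox w hw; omega)
              (by have := hbox w hw; omega)
              (Or.inl (hbox w hw).1)
            hWo := hWo
            a := a₆, b := b₆, u := u, V := V, P := P
            hab := ⟨ha₆, hb₆⟩
            hV := fun w hw => ?_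
            hVo := fun e he => hV₆e e (hVe e he)
            hu := huV
            hP := fun w hw => ?_
            hPo := fun e he => hT₃e e (hPe e he)
            a' := a₇, b' := b₇, u' := u', V' := V', P' := P'
            hab' := ⟨ha₇, hb₇⟩
            hV' := fun w hw => ?_
            hV'o := fun e he => hV₇e e (hV'e e he)
            hu' := hu'V
            hP' := fun w hw => ?_
            hP'o := fun e he => hT₁e e (hP'e e he) }, fun v hv => ?_⟩
  · obtain ⟨h1, h2, h3⟩ := hVs w hw
    have := hV₆s w h3
    exact ⟨by omega, by omega, abs_le.2 ⟨by omega, by omega⟩⟩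
  · have := hT₃s w (hPs w hw)
    rw [hz0]
    constructor
    · have : |w 0 - (N : ℤ)| ≤ A := abs_le.2 ⟨by omega, by omega⟩; omega
    · have : |w 1 - z 1| ≤ (n / 64 : ℕ) := abs_le.2 ⟨by omega, by omega⟩; omega
  · obtain ⟨h1, h2, h3⟩ := hV's w hw
    have := hV₇s w h3
    exact ⟨by omega, by omega, abs_le.2 ⟨by omega, by omega⟩⟩
  · have := hT₁s w (hP's w hw)
    rw [hx0]
    constructor
    · have : |w 0 - (n : ℤ)| ≤ a := abs_le.2 ⟨by omega, by omega⟩; omega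
    · have : |w 1 - x 1| ≤ (n / 64 : ℕ) := abs_le.2 ⟨by omega, by omega⟩; omega
  · -- rows of the carrier
    simp only [ZdSepOpenArmR.carrier, Set.mem_setOf_eq] at hv
    rcases hv with hv | hv | hv | hv | hv
    · have := hbox v hv; omega
    · have := hV₆s v (hVs v hv).2.2; have := (hVs v hv).1; omega
    · have := hT₃s v (hPs v hv); omega
    · have := hV₇s v (hV's v hv).2.2; have := (hV's v hv).1; have := (hV's v hv).2.1; omega
    · have := hT₁s v (hP's v hv); omega


end ArmRRowsDesc

end Literature.Probability.Percolation

end
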